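import Summits.SmoothPoincare4.SmoothPoincare4.Theorems.ConvexBisectionAcyclicBisectionExistsStdSympChain
import HarnessLib

/-!
# The chain transvections alone are NOT transitive on primitive vectors (`g ≥ 2`): a parity
# invariant (wave 6, brick G6-0 — correction of the route of node N3a `node_STcurve` of stub
# `stub_STgeo` = NF4 N3, line `modp-braid-orbits`, crux `ConvexBisection.AcyclicBisectionExists`,
# item stmt-SmoothPoincare4-10508; registered sub-goal `helper_chain_transvection_orbit_proper`)

The design of N3a (NF4_Design.lean) proposed: "`Sp(2g, ℤ) = ⟨transvections along chainVec⟩` acts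
transitively on primitive vectors".  This is FALSE for every `g ≥ 2`: the `2g` signed transvections
`transvection (stdSymp ℤ g) (chainVec g i, ±)` (`SignedHurwitzAction.lean`,
`LefschetzBasePages.lean`) preserve the PARITY of

  `q(x) = Σ_j x_{e_j} x_{f_j} + Σ_j (j + 1) x_{e_j} + Σ_j x_{f_j}`      (written out as a sum in every statement; no definition)

because `q` is a quadratic refinement mod `2` of the symplectic form taking the value `1` on every
chain vector (`chainParity_transvection_sub`: `q(T_a^{±} x) − q(x) ≡ ω(a,x)·(1 + q(a)) (mod 2)`;
`not_two_dvd_chainParity_chainVec`).  Hence the orbit of `chainVec g 0 = e_0` (`q = 1`) misses the primitive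
vector `e_1` (`q = 2`): **`helper_chain_transvection_orbit_proper`**.  (Geometrically: the chain
twists generate the hyperelliptic mapping class group — the image of the braid group `B_{2g+1}`
(Birman–Hilden) — whose reduction mod `2` is `S_{2g+1} ⊊ Sp(2g, 𝔽₂)`.)  The corrected algebra, with
the extra generators `e_j`, is `…PrimitiveOrbitPair.lean` / `…PrimitiveOrbit.lean`.

No definitions; everything is proved; no named facts, no `sorry`.  Reference: B. Farb, D. Margalit, *A primer on mapping class groups*
(2012), §9.4 (Birman–Hilden), §6.1. [folklore]
-/

noncomputable section

set_option linter.dupNamespace false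

open Set Function
open Literature.Topology.FourManifolds Literature.Topology.FourManifolds.LefschetzBase
  Literature.GroupTheory.CombinatorialGroupTheory.SignedHurwitz

namespace Summit.SmoothPoincare4.SmoothPoincare4.Theorems.AcyclicBisectionExists.ModpBraidOrbits

variable {g : ℕ}

/-- Expansion of the parity form along a translate `x + c • a`. [folklore] -/
theorem chainParity_add_smul (x a : Fin g ⊕ Fin g → ℤ) (c : ℤ) :
    (∑ l, (x + c • a) (Sum.inl l) * (x + c • a) (Sum.inr l) + ∑ l : Fin g, (((l : ℕ) : ℤ) + 1) * (x + c • a) (Sum.inl l) + ∑ l, (x + c • a) (Sum.inr l)) =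
      (∑ l, (x) (Sum.inl l) * (x) (Sum.inr l) + ∑ l : Fin g, (((l : ℕ) : ℤ) + 1) * (x) (Sum.inl l) + ∑ l, (x) (Sum.inr l)) +
      c * ∑ j, (x (Sum.inl j) * a (Sum.inr j) + a (Sum.inl j) * x (Sum.inr j)) +
      c ^ 2 * ∑ j, a (Sum.inl j) * a (Sum.inr j) +
      c * (∑ j : Fin g, (((j : ℕ) : ℤ) + 1) * a (Sum.inl j) + ∑ j, a (Sum.inr j)) := by
  have h1 : ∑ j, (x + c • a) (Sum.inl j) * (x + c • a) (Sum.inr j) =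
      ∑ j, x (Sum.inl j) * x (Sum.inr j) +
        c * ∑ j, (x (Sum.inl j) * a (Sum.inr j) + a (Sum.inl j) * x (Sum.inr j)) +
        c ^ 2 * ∑ j, a (Sum.inl j) * a (Sum.inr j) := by
    rw [Finset.mul_sum, Finset.mul_sum, ← Finset.sum_add_distrib, ← Finset.sum_add_distrib]
    refine Finset.sum_congr rfl fun j _ => ?_
    simp only [Pi.add_apply, Pi.smul_apply, smul_eq_mul]
    ring
  have h2 : ∑ j : Fin g, (((j : ℕ) : ℤ) + 1) * (x + c • a) (Sum.inl j) =
      ∑ j : Fin g, (((j : ℕ) : ℤ) + 1) * x (Sum.inl j) + c * ∑ j : Fin g, (((j : ℕ) : ℤ) + 1) * a (Sum.inl j) := by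
    rw [Finset.mul_sum, ← Finset.sum_add_distrib]
    refine Finset.sum_congr rfl fun j _ => ?_
    simp only [Pi.add_apply, Pi.smul_apply, smul_eq_mul]
    ring
  have h3 : ∑ j, (x + c • a) (Sum.inr j) = ∑ j, x (Sum.inr j) + c * ∑ j, a (Sum.inr j) := by
    rw [Finset.mul_sum, ← Finset.sum_add_distrib]
    refine Finset.sum_congr rfl fun j _ => ?_
    simp only [Pi.add_apply, Pi.smul_apply, smul_eq_mul]
  rw [h1, h2, h3]
  ring

/-- The symmetrised cross term is the symplectic pairing up to an even error. [folklore] -/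
theorem cross_eq_stdSymp_add (a x : Fin g ⊕ Fin g → ℤ) :
    ∑ j, (x (Sum.inl j) * a (Sum.inr j) + a (Sum.inl j) * x (Sum.inr j)) =
      stdSymp ℤ g a x + 2 * ∑ j, a (Sum.inr j) * x (Sum.inl j) := by
  rw [stdSymp_int_apply, Finset.mul_sum, ← Finset.sum_add_distrib]
  exact Finset.sum_congr rfl fun j _ => by ring

/-- The truth table behind the invariance (over `ZMod 2`). [folklore] -/
theorem zmod_two_identity : ∀ b q₀ l t u : ZMod 2, q₀ + l = 1 →
    u * b * (b + 2 * t) + (u * b) ^ 2 * q₀ + u * b * l = 0 := by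
  decide

/-- `sgn s` is `1` mod `2`… up to sign: its square is `1`. [folklore] -/
theorem sgn_int_cast_zmod_two (s : Bool) : ((sgn s : ℤ) : ZMod 2) = 1 := by
  cases s
  · rw [sgn_false]; decide
  · rw [sgn_true, Int.cast_one]

/-- **Invariance mod 2**: a transvection along a vector of ODD parity preserves the parity form
mod `2` (`q(x + λa) − q(x) ≡ λ(1 + q(a))` with `λ ≡ ω(a, x)`). [folklore] -/
theorem chainParity_transvection_sub (a x : Fin g ⊕ Fin g → ℤ) (s : Bool)
    (ha : ¬(2 : ℤ) ∣ (∑ l, (a) (Sum.inl l) * (a) (Sum.inr l) + ∑ l : Fin g, (((l : ℕ) : ℤ) + 1) * (a) (Sum.inl l) + ∑ l, (a) (Sum.inr l))) :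
    (2 : ℤ) ∣ (∑ l, (transvection (stdSymp ℤ g) (a, s) x) (Sum.inl l) * (transvection (stdSymp ℤ g) (a, s) x) (Sum.inr l) + ∑ l : Fin g, (((l : ℕ) : ℤ) + 1) * (transvection (stdSymp ℤ g) (a, s) x) (Sum.inl l) + ∑ l, (transvection (stdSymp ℤ g) (a, s) x) (Sum.inr l)) -
      (∑ l, (x) (Sum.inl l) * (x) (Sum.inr l) + ∑ l : Fin g, (((l : ℕ) : ℤ) + 1) * (x) (Sum.inl l) + ∑ l, (x) (Sum.inr l)) := by
  rw [transvection_apply]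
  dsimp only
  rw [chainParity_add_smul, cross_eq_stdSymp_add]
  have hq : ((∑ j, a (Sum.inl j) * a (Sum.inr j) : ℤ) : ZMod 2) +
      ((∑ j : Fin g, (((j : ℕ) : ℤ) + 1) * a (Sum.inl j) + ∑ j, a (Sum.inr j) : ℤ) : ZMod 2) = 1 := by
    have h2 : (((∑ l, (a) (Sum.inl l) * (a) (Sum.inr l) + ∑ l : Fin g, (((l : ℕ) : ℤ) + 1) * (a) (Sum.inl l) + ∑ l, (a) (Sum.inr l)) : ℤ) : ZMod 2) ≠ 0 := by
      rw [Ne, ZMod.intCast_zmod_eq_zero_iff_dvd]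
      exact_mod_cast ha
    have h3 : ∀ z : ZMod 2, z ≠ 0 → z = 1 := by decide
    have h4 := h3 _ h2
    push_cast at h4 ⊢
    linear_combination h4
  suffices h : (((∑ l, (x) (Sum.inl l) * (x) (Sum.inr l) + ∑ l : Fin g, (((l : ℕ) : ℤ) + 1) * (x) (Sum.inl l) + ∑ l, (x) (Sum.inr l)) + sgn s * stdSymp ℤ g a x * (stdSymp ℤ g a x + 2 * ∑ j, a (Sum.inr j) * x (Sum.inl j)) +
      (sgn s * stdSymp ℤ g a x) ^ 2 * ∑ j, a (Sum.inl j) * a (Sum.inr j) +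
      sgn s * stdSymp ℤ g a x * (∑ j : Fin g, (((j : ℕ) : ℤ) + 1) * a (Sum.inl j) + ∑ j, a (Sum.inr j)) -
      (∑ l, (x) (Sum.inl l) * (x) (Sum.inr l) + ∑ l : Fin g, (((l : ℕ) : ℤ) + 1) * (x) (Sum.inl l) + ∑ l, (x) (Sum.inr l)) : ℤ) : ZMod 2) = 0 by
    have h' := (ZMod.intCast_zmod_eq_zero_iff_dvd _ 2).1 h
    exact_mod_cast h'
  push_cast
  rw [sgn_int_cast_zmod_two]
  have key := zmod_two_identity ((stdSymp ℤ g a x : ℤ) : ZMod 2)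
    ((∑ j, a (Sum.inl j) * a (Sum.inr j) : ℤ) : ZMod 2)
    ((∑ j : Fin g, (((j : ℕ) : ℤ) + 1) * a (Sum.inl j) + ∑ j, a (Sum.inr j) : ℤ) : ZMod 2)
    ((∑ j, a (Sum.inr j) * x (Sum.inl j) : ℤ) : ZMod 2) 1 hq
  push_cast at key
  linear_combination key

/-- Parity of `f_j`: `q(f_j) = 1`. [folklore] -/
theorem chainParity_single_inr (j : Fin g) :
    (∑ l, ((Pi.single (Sum.inr j) 1 : Fin g ⊕ Fin g → ℤ)) (Sum.inl l) * ((Pi.single (Sum.inr j) 1 : Fin g ⊕ Fin g → ℤ)) (Sum.inr l) + ∑ l : Fin g, (((l : ℕ) : ℤ) + 1) * ((Pi.single (Sum.inr j) 1 : Fin g ⊕ Fin g → ℤ)) (Sum.inl l) + ∑ l, ((Pi.single (Sum.inr j) 1 : Fin g ⊕ Fin g → ℤ)) (Sum.inr l)) = 1 := by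
  simp [Pi.single_apply, Finset.sum_ite_eq']

/-- Parity of `e_j`: `q(e_j) = j + 1`. [folklore] -/
theorem chainParity_single_inl (j : Fin g) :
    (∑ l, ((Pi.single (Sum.inl j) 1 : Fin g ⊕ Fin g → ℤ)) (Sum.inl l) * ((Pi.single (Sum.inl j) 1 : Fin g ⊕ Fin g → ℤ)) (Sum.inr l) + ∑ l : Fin g, (((l : ℕ) : ℤ) + 1) * ((Pi.single (Sum.inl j) 1 : Fin g ⊕ Fin g → ℤ)) (Sum.inl l) + ∑ l, ((Pi.single (Sum.inl j) 1 : Fin g ⊕ Fin g → ℤ)) (Sum.inr l)) = ((j : ℕ) : ℤ) + 1 := by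
  simp [Pi.single_apply, Finset.sum_ite_eq']

/-- Parity of `e_j − e_k`: `q(e_j − e_k) = j − k`. [folklore] -/
theorem chainParity_single_inl_sub (j k : Fin g) :
    (∑ l, (Pi.single (Sum.inl j) 1 - Pi.single (Sum.inl k) 1 : Fin g ⊕ Fin g → ℤ) (Sum.inl l) * (Pi.single (Sum.inl j) 1 - Pi.single (Sum.inl k) 1 : Fin g ⊕ Fin g → ℤ) (Sum.inr l) + ∑ l : Fin g, (((l : ℕ) : ℤ) + 1) * (Pi.single (Sum.inl j) 1 - Pi.single (Sum.inl k) 1 : Fin g ⊕ Fin g → ℤ) (Sum.inl l) + ∑ l, (Pi.single (Sum.inl j) 1 - Pi.single (Sum.inl k) 1 : Fin g ⊕ Fin g → ℤ) (Sum.inr l)) =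
      ((j : ℕ) : ℤ) - ((k : ℕ) : ℤ) := by
  simp [Pi.single_apply, Finset.sum_sub_distrib, mul_sub, Finset.sum_ite_eq']

/-- **The parity form is odd on every chain vector.** [folklore] -/
theorem not_two_dvd_chainParity_chainVec {i : ℕ} (hi : i < 2 * g) :
    ¬(2 : ℤ) ∣ (∑ l, (chainVec g i) (Sum.inl l) * (chainVec g i) (Sum.inr l) + ∑ l : Fin g, (((l : ℕ) : ℤ) + 1) * (chainVec g i) (Sum.inl l) + ∑ l, (chainVec g i) (Sum.inr l)) := by
  obtain ⟨j, rfl | rfl⟩ : ∃ j : ℕ, i = 2 * j ∨ i = 2 * j + 1 := ⟨i / 2, by omega⟩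
  · have hj : j < g := by omega
    have h1 := chainVec_even g ⟨j, hj⟩
    dsimp only at h1
    rw [h1]
    by_cases h0 : 0 < j
    · rw [if_pos h0, chainParity_single_inl_sub]
      dsimp only
      omega
    · rw [if_neg h0, sub_zero, chainParity_single_inl]
      dsimp only
      omega
  · have hj : j < g := by omega
    have h1 := chainVec_odd g ⟨j, hj⟩
    dsimp only at h1
    rw [h1, chainParity_single_inr]
    omega

/-- **Parity is invariant along the orbit of the chain transvections.** [folklore] -/
theorem not_two_dvd_chainParity_of_orbit {x y : Fin g ⊕ Fin g → ℤ}
    (h : Relation.ReflTransGen (fun x y : Fin g ⊕ Fin g → ℤ => ∃ (i : ℕ) (s : Bool), i < 2 * g ∧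
      y = transvection (stdSymp ℤ g) (chainVec g i, s) x) x y)
    (hx : ¬(2 : ℤ) ∣ (∑ l, (x) (Sum.inl l) * (x) (Sum.inr l) + ∑ l : Fin g, (((l : ℕ) : ℤ) + 1) * (x) (Sum.inl l) + ∑ l, (x) (Sum.inr l))) :
    ¬(2 : ℤ) ∣ (∑ l, (y) (Sum.inl l) * (y) (Sum.inr l) + ∑ l : Fin g, (((l : ℕ) : ℤ) + 1) * (y) (Sum.inl l) + ∑ l, (y) (Sum.inr l)) := by
  induction h with
  | refl => exact hx
  | @tail b c _ hst ih =>
    obtain ⟨i, s, hi, rfl⟩ := hst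
    intro h2
    have h3 := chainParity_transvection_sub (chainVec g i) b s (not_two_dvd_chainParity_chainVec hi)
    exact ih (by simpa using dvd_sub h2 h3)

/-- **The chain transvections are not transitive on primitive vectors for `g ≥ 2`**: the orbit of
`chainVec g 0 = e_0` (odd parity) misses the primitive vector `e_1` (parity `q(e_1) = 2`).
[cite: FarbMargalit2012, §9.4] -/
theorem chain_transvection_orbit_proper (hg : 2 ≤ g) :
    ∃ v : Fin g ⊕ Fin g → ℤ, IsPrimitive v ∧
      ¬Relation.ReflTransGen (fun x y : Fin g ⊕ Fin g → ℤ => ∃ (i : ℕ) (s : Bool), i < 2 * g ∧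
        y = transvection (stdSymp ℤ g) (chainVec g i, s) x) (chainVec g 0) v := by
  refine ⟨Pi.single (Sum.inl ⟨1, by omega⟩) 1, isPrimitive_of_apply_eq_one (k := Sum.inl ⟨1, by omega⟩)
    (by simp), fun h => ?_⟩
  have h1 := not_two_dvd_chainParity_of_orbit h (not_two_dvd_chainParity_chainVec (by omega))
  rw [chainParity_single_inl] at h1
  exact h1 ⟨1, by norm_num⟩

/-- **Sub-goal `helper_chain_transvection_orbit_proper`** (G6-0, correction of the route of node
N3a `node_STcurve`): for `g ≥ 2` some primitive vector of `ℤ^{2g}` is NOT reached from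
`chainVec g 0` by signed transvections along the `2g` chain vectors alone.
[cite: FarbMargalit2012, §9.4] -/
theorem helper_chain_transvection_orbit_proper : ∀ (g : ℕ), 2 ≤ g → ∃ v : Fin g ⊕ Fin g → ℤ, Literature.GroupTheory.CombinatorialGroupTheory.SignedHurwitz.IsPrimitive v ∧ ¬Relation.ReflTransGen (fun x y : Fin g ⊕ Fin g → ℤ => ∃ (i : ℕ) (s : Bool), i < 2 * g ∧ y = Literature.GroupTheory.CombinatorialGroupTheory.SignedHurwitz.transvection (Literature.GroupTheory.CombinatorialGroupTheory.SignedHurwitz.stdSymp ℤ g) (Literature.Topology.FourManifolds.LefschetzBase.chainVec g i, s) x) (Literature.Topology.FourManifolds.LefschetzBase.chainVec g 0) v :=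
  fun _ hg => chain_transvection_orbit_proper hg

end Summit.SmoothPoincare4.SmoothPoincare4.Theorems.AcyclicBisectionExists.ModpBraidOrbits

end
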